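import Mathlib
import Summits.Ventures.PercRepro2.Defs
import Summits.Ventures.PercRepro2.Graph
import Summits.Ventures.PercRepro2.Events
import Summits.Ventures.PercRepro2.CycleDefs
import Summits.Ventures.PercRepro2.CycleTerm

/-!
# The negative colourings of a cycle and the decoder of the injection (blind cell PercRepro2, mine-a g47)

For a negative colouring of the antipodal 2-colouring sum of `CycleTerm` that is red at `min D`
and blue at `max D` (`neg_min_spec`): with `l` the last red and `f` the first blue position,
`l < h` (the hit weight), `min D < l < max D`, `min D < f`, and the union arc `V ∖ (f, l]` — the
arc of the colouring with red hull `[f, l]` — lies in both families `𝓤 𝓥`; `neg_max_spec` is the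
mirror (`h ≤ f`).  `psi` is the explicit inverse of the injection `phi` on its image: a singleton
decodes to an initial or final segment of `D` according to the side of `h`, a set with
`min ρ < max ρ` by restoring the red initial or final segment.  MINE-A.md §102.2,
proofs/MINEA-CYCLE.md.  No instance, no notation.
-/

namespace Summit.Ventures.PercRepro2

namespace TCycle

open Finset

variable {n : ℕ}

/-! ## Red at the minimum: the first one-sided type -/

section NegMin

variable {D : Finset (Fin (n + 1))} (hD : D.Nonempty) {h : Fin (n + 1)}
  {𝓤 𝓥 : Set (Set (Fin (n + 1)))}

/-- **Red at `min D`, blue at `max D`, negative term**: with `l` the last red and `f` the first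
blue position, `l < h`, `min D < l < max D`, `min D < f`, the union arc `V ∖ (f, l]` lies in both
families while the arc of `D` lies in neither, and everything lies in both. -/
lemma neg_min_spec (hU : IsUpperSet 𝓤) (hV : IsUpperSet 𝓥) (hh0 : D.min' hD < h)
    {τ : Finset (Fin (n + 1))} (hτ : τ ⊆ D) (h0 : D.min' hD ∈ τ) (h1 : D.max' hD ∉ τ)
    (hw : wt D h 𝓤 𝓥 τ = -1) :
    τ.max' ⟨_, h0⟩ < h ∧ D.min' hD < τ.max' ⟨_, h0⟩ ∧ τ.max' ⟨_, h0⟩ < D.max' hD ∧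
      D.min' hD < (D \ τ).min' ⟨_, mem_sdiff.2 ⟨D.max'_mem hD, h1⟩⟩ ∧
      {v | v ≤ (D \ τ).min' ⟨_, mem_sdiff.2 ⟨D.max'_mem hD, h1⟩⟩ ∨ τ.max' ⟨_, h0⟩ < v} ∈ 𝓤 ∧
      {v | v ≤ (D \ τ).min' ⟨_, mem_sdiff.2 ⟨D.max'_mem hD, h1⟩⟩ ∨ τ.max' ⟨_, h0⟩ < v} ∈ 𝓥 := by
  set l := τ.max' ⟨_, h0⟩ with hl
  set f := (D \ τ).min' ⟨_, mem_sdiff.2 ⟨D.max'_mem hD, h1⟩⟩ with hf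
  have hlτ : l ∈ τ := τ.max'_mem _
  have hfD : f ∈ D \ τ := (D \ τ).min'_mem _
  have hfτ : f ∉ τ := (mem_sdiff.1 hfD).2
  have harc : arc τ = {v | v ≤ D.min' hD ∨ l < v} := arc_of_min_mem D hD hτ h0
  have harc' : arc (D \ τ) = {v | v ≤ f ∨ D.max' hD < v} := arc_sdiff_of_max_notMem D hD h1
  obtain ⟨hh, hc⟩ := of_wt_eq_neg_one hw
  -- `l < h`
  have hlh : l < h := by
    rw [harc] at hh
    rcases hh with hh | hh
    · exact absurd hh (not_le.2 hh0)
    · exact hh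
  -- `min D < l`: otherwise `τ = {min D}` and the red arc is everything
  have h0l : D.min' hD < l := by
    rcases lt_or_eq_of_le (D.min'_le l (hτ hlτ)) with hlt | heq
    · exact hlt
    · exfalso
      have hsub : arc (D \ τ) ⊆ arc τ := by
        rw [harc, ← heq]
        intro v _
        by_cases hv : v ≤ D.min' hD
        · exact Or.inl hv
        · exact Or.inr (lt_of_not_ge hv)
      have := wt_nonneg_of_superset (D := D) (h := h) hU hV hsub
      omega
  -- `l < max D`
  have hl1 : l < D.max' hD :=
    lt_of_le_of_ne (D.le_max' l (hτ hlτ)) fun heq => h1 (heq ▸ hlτ)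
  -- `min D < f`
  have h0f : D.min' hD < f :=
    lt_of_le_of_ne (D.min'_le f (mem_sdiff.1 hfD).1) fun heq => hfτ (heq ▸ h0)
  -- the union arc contains both arcs
  have hW1 : arc τ ⊆ {v | v ≤ f ∨ l < v} := by
    rw [harc]
    rintro v (hv | hv)
    · exact Or.inl (le_trans hv h0f.le)
    · exact Or.inr hv
  have hW2 : arc (D \ τ) ⊆ {v | v ≤ f ∨ l < v} := by
    rw [harc']
    rintro v (hv | hv)
    · exact Or.inl hv
    · exact Or.inr (lt_trans hl1 hv)
  refine ⟨hlh, h0l, hl1, h0f, ?_, ?_⟩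
  · rcases hc with ⟨hU1, -, -, -⟩ | ⟨-, hU2, -, -⟩
    · exact hU hW1 hU1
    · exact hU hW2 hU2
  · rcases hc with ⟨-, -, -, hV2⟩ | ⟨-, -, hV1, -⟩
    · exact hV hW2 hV2
    · exact hV hW1 hV1

end NegMin

/-! ## Red at the maximum: the second one-sided type -/

section NegMax

variable {D : Finset (Fin (n + 1))} (hD : D.Nonempty) {h : Fin (n + 1)}
  {𝓤 𝓥 : Set (Set (Fin (n + 1)))}

/-- **Blue at `min D`, red at `max D`, negative term**: with `f` the first red and `l` the last blue
position, `h ≤ f`, `min D < f < max D`, `l < max D`, and the union arc `V ∖ (f, l]` lies in both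
families. -/
lemma neg_max_spec (hU : IsUpperSet 𝓤) (hV : IsUpperSet 𝓥) (hh1 : h ≤ D.max' hD)
    {τ : Finset (Fin (n + 1))} (hτ : τ ⊆ D) (h0 : D.min' hD ∉ τ) (h1 : D.max' hD ∈ τ)
    (hw : wt D h 𝓤 𝓥 τ = -1) :
    h ≤ τ.min' ⟨_, h1⟩ ∧ D.min' hD < τ.min' ⟨_, h1⟩ ∧ τ.min' ⟨_, h1⟩ < D.max' hD ∧
      (D \ τ).max' ⟨_, mem_sdiff.2 ⟨D.min'_mem hD, h0⟩⟩ < D.max' hD ∧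
      {v | v ≤ τ.min' ⟨_, h1⟩ ∨ (D \ τ).max' ⟨_, mem_sdiff.2 ⟨D.min'_mem hD, h0⟩⟩ < v} ∈ 𝓤 ∧
      {v | v ≤ τ.min' ⟨_, h1⟩ ∨ (D \ τ).max' ⟨_, mem_sdiff.2 ⟨D.min'_mem hD, h0⟩⟩ < v} ∈ 𝓥 := by
  set f := τ.min' ⟨_, h1⟩ with hf
  set l := (D \ τ).max' ⟨_, mem_sdiff.2 ⟨D.min'_mem hD, h0⟩⟩ with hl
  have hfτ : f ∈ τ := τ.min'_mem _
  have hlD : l ∈ D \ τ := (D \ τ).max'_mem _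
  have hlτ : l ∉ τ := (mem_sdiff.1 hlD).2
  have harc : arc τ = {v | v ≤ f ∨ D.max' hD < v} := arc_of_max_mem D hD hτ h1
  have harc' : arc (D \ τ) = {v | v ≤ D.min' hD ∨ l < v} := arc_sdiff_of_min_notMem D hD h0
  obtain ⟨hh, hc⟩ := of_wt_eq_neg_one hw
  -- `h ≤ f`
  have hhf : h ≤ f := by
    rw [harc] at hh
    rcases hh with hh | hh
    · exact hh
    · exact absurd hh (not_lt.2 hh1)
  -- `f < max D`: otherwise `τ = {max D}` and the red arc is everything
  have hf1 : f < D.max' hD := by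
    rcases lt_or_eq_of_le (D.le_max' f (hτ hfτ)) with hlt | heq
    · exact hlt
    · exfalso
      have hsub : arc (D \ τ) ⊆ arc τ := by
        rw [harc, heq]
        intro v _
        by_cases hv : v ≤ D.max' hD
        · exact Or.inl hv
        · exact Or.inr (lt_of_not_ge hv)
      have := wt_nonneg_of_superset (D := D) (h := h) hU hV hsub
      omega
  -- `min D < f`
  have h0f : D.min' hD < f :=
    lt_of_le_of_ne (D.min'_le f (hτ hfτ)) fun heq => h0 (heq ▸ hfτ)
  -- `l < max D`
  have hl1 : l < D.max' hD :=
    lt_of_le_of_ne (D.le_max' l (mem_sdiff.1 hlD).1) fun heq => hlτ (heq ▸ h1)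
  -- the union arc contains both arcs
  have hW1 : arc τ ⊆ {v | v ≤ f ∨ l < v} := by
    rw [harc]
    rintro v (hv | hv)
    · exact Or.inl hv
    · exact Or.inr (lt_trans hl1 hv)
  have hW2 : arc (D \ τ) ⊆ {v | v ≤ f ∨ l < v} := by
    rw [harc']
    rintro v (hv | hv)
    · exact Or.inl (le_trans hv h0f.le)
    · exact Or.inr hv
  refine ⟨hhf, h0f, hf1, hl1, ?_, ?_⟩
  · rcases hc with ⟨hU1, -, -, -⟩ | ⟨-, hU2, -, -⟩
    · exact hU hW1 hU1
    · exact hU hW2 hU2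
  · rcases hc with ⟨-, -, -, hV2⟩ | ⟨-, -, hV1, -⟩
    · exact hV hW2 hV2
    · exact hV hW1 hV1

end NegMax

/-! ## The decoder: an explicit inverse of `phi` on the negative colourings -/

section Decode

variable (D : Finset (Fin (n + 1))) (hD : D.Nonempty) (h : Fin (n + 1))

open Classical in
/-- The inverse of `phi` on its image: a singleton `{x}` decodes to the initial segment up to `x`
when `x < h` and to the final segment from `x` otherwise; a set with `min ρ < max ρ` decodes by
restoring the red initial segment below `min ρ` when `max ρ < h`, the red final segment above
`max ρ` otherwise. -/
noncomputable def psi (ρ : Finset (Fin (n + 1))) : Finset (Fin (n + 1)) :=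
  if hρ : ρ.Nonempty then
    (if ρ.min' hρ = ρ.max' hρ then
      (if ρ.min' hρ < h then D.filter (fun x => x ≤ ρ.min' hρ)
        else D.filter (fun x => ρ.min' hρ ≤ x))
    else
      (if ρ.max' hρ < h then (ρ \ {ρ.min' hρ}) ∪ D.filter (fun x => x < ρ.min' hρ)
        else (ρ \ {ρ.max' hρ}) ∪ D.filter (fun x => ρ.max' hρ < x)))
  else ∅

/-- `phi` on a colouring that is red at the minimum and blue at the maximum. -/
lemma phi_eq_of_min {τ : Finset (Fin (n + 1))} (h0 : D.min' hD ∈ τ) (h1 : D.max' hD ∉ τ) :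
    phi D hD τ =
      if (D \ τ).min' ⟨_, mem_sdiff.2 ⟨D.max'_mem hD, h1⟩⟩ < τ.max' ⟨_, h0⟩ then
        flipLow τ ((D \ τ).min' ⟨_, mem_sdiff.2 ⟨D.max'_mem hD, h1⟩⟩)
      else {τ.max' ⟨_, h0⟩} := by
  unfold phi
  rw [dif_pos ⟨h0, h1⟩]

/-- `phi` on a colouring that is blue at the minimum and red at the maximum. -/
lemma phi_eq_of_max {τ : Finset (Fin (n + 1))} (h0 : D.min' hD ∉ τ) (h1 : D.max' hD ∈ τ) :
    phi D hD τ =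
      if τ.min' ⟨_, h1⟩ < (D \ τ).max' ⟨_, mem_sdiff.2 ⟨D.min'_mem hD, h0⟩⟩ then
        flipHigh τ ((D \ τ).max' ⟨_, mem_sdiff.2 ⟨D.min'_mem hD, h0⟩⟩)
      else {τ.min' ⟨_, h1⟩} := by
  unfold phi
  rw [dif_neg (fun hc => h0 hc.1), dif_pos ⟨h0, h1⟩]

/-- The minimum of `flipLow τ f` is `f`. -/
lemma min'_flipLow {τ : Finset (Fin (n + 1))} {f : Fin (n + 1)}
    (hne : (flipLow τ f).Nonempty) : (flipLow τ f).min' hne = f := by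
  apply le_antisymm
  · exact (flipLow τ f).min'_le f (mem_flipLow.2 (Or.inl rfl))
  · apply (flipLow τ f).le_min'
    intro y hy
    rcases mem_flipLow.1 hy with rfl | ⟨_, hfy⟩
    · exact le_rfl
    · exact hfy.le

/-- The maximum of `flipLow τ f` is the maximum `l` of `τ` when `f < l`. -/
lemma max'_flipLow {τ : Finset (Fin (n + 1))} {f l : Fin (n + 1)} (hl : l ∈ τ)
    (hmax : ∀ x ∈ τ, x ≤ l) (hfl : f < l) (hne : (flipLow τ f).Nonempty) :
    (flipLow τ f).max' hne = l := by
  apply le_antisymm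
  · apply (flipLow τ f).max'_le
    intro y hy
    rcases mem_flipLow.1 hy with rfl | ⟨hy, _⟩
    · exact hfl.le
    · exact hmax y hy
  · exact (flipLow τ f).le_max' l (mem_flipLow.2 (Or.inr ⟨hl, hfl⟩))

/-- The maximum of `flipHigh τ l` is `l`. -/
lemma max'_flipHigh {τ : Finset (Fin (n + 1))} {l : Fin (n + 1)}
    (hne : (flipHigh τ l).Nonempty) : (flipHigh τ l).max' hne = l := by
  apply le_antisymm
  · apply (flipHigh τ l).max'_le
    intro y hy
    rcases mem_flipHigh.1 hy with rfl | ⟨_, hyl⟩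
    · exact le_rfl
    · exact hyl.le
  · exact (flipHigh τ l).le_max' l (mem_flipHigh.2 (Or.inl rfl))

/-- The minimum of `flipHigh τ l` is the minimum `f` of `τ` when `f < l`. -/
lemma min'_flipHigh {τ : Finset (Fin (n + 1))} {f l : Fin (n + 1)} (hf : f ∈ τ)
    (hmin : ∀ x ∈ τ, f ≤ x) (hfl : f < l) (hne : (flipHigh τ l).Nonempty) :
    (flipHigh τ l).min' hne = f := by
  apply le_antisymm
  · exact (flipHigh τ l).min'_le f (mem_flipHigh.2 (Or.inr ⟨hf, hfl⟩))
  · apply (flipHigh τ l).le_min'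
    intro y hy
    rcases mem_flipHigh.1 hy with rfl | ⟨hy, _⟩
    · exact hfl.le
    · exact hmin y hy

/-- Decoding a singleton. -/
lemma psi_singleton (x : Fin (n + 1)) :
    psi D h {x} = if x < h then D.filter (fun y => y ≤ x) else D.filter (fun y => x ≤ y) := by
  unfold psi
  rw [dif_pos (singleton_nonempty x)]
  simp only [min'_singleton, max'_singleton, if_true]

/-- Decoding a set with distinct minimum and maximum. -/
lemma psi_of_ne {ρ : Finset (Fin (n + 1))} (hρ : ρ.Nonempty) (hne : ρ.min' hρ ≠ ρ.max' hρ) :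
    psi D h ρ =
      if ρ.max' hρ < h then (ρ \ {ρ.min' hρ}) ∪ D.filter (fun x => x < ρ.min' hρ)
        else (ρ \ {ρ.max' hρ}) ∪ D.filter (fun x => ρ.max' hρ < x) := by
  unfold psi
  rw [dif_pos hρ, if_neg hne]

end Decode

end TCycle

end Summit.Ventures.PercRepro2
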